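import Literature.Topology.FourManifolds.KirbyMovesSurgery
import Literature.Topology.FourManifolds.KirbyMovesIsotopyProofs
import Literature.Topology.FourManifolds.KirbyMovesReverseProofs
import HarnessLib

/-!
# Towards `KirbyEquivalent.nonempty_diffeomorph_holds`: the assembly with leaves (I), (V) discharged

Sibling proof file of `KirbyMovesSurgery.lean`. Of the leaves of the decomposition of Kirby's
theorem ("if" direction, `Literature.Topology.FourManifolds.KirbyEquivalent.nonempty_diffeomorph`) recorded there, (R)
renumbering (`FramedLink.IsSurgery.reindex`, `KirbyMovesProofs.lean`), (I) isotopy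
(`FramedLink.IsSurgery.of_isIsotopic_holds`, `KirbyMovesIsotopyProofs.lean`) and (V) reversing a
component (`FramedLink.IsSurgery.reverseComponent_holds`, `KirbyMovesReverseProofs.lean`) are
proved; this file feeds them into the proved assembly theorems, leaving as hypotheses only the
four open leaves (E) `FramedLink.exists_isSurgery`, (U) `FramedLink.IsSurgery.nonempty_diffeomorph`,
(B) `FramedLink.IsBlowDown.isSurgery`, (H) `FramedLink.IsHandleSlide.isSurgery`:

* `Literature.KirbyMove.isSurgery_of_blowDown_handleSlide hbd hhs` — a Kirby move does not change the
  surgered manifold, given (B) and (H);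
* `Literature.KirbyEquivalent.nonempty_diffeomorph_of_leaves hex huniq₀ huniq₁ huniq₂ hbd hhs :
  KirbyEquivalent.nonempty_diffeomorph` — the named fact from (E), (U) (three universe instances),
  (B), (H).

Kirby (1978), Thm 1; Kirby (1989), Ch. I §5 Thm 5.1; Juhász (2023), Thm 6.4.

**Deprecation (2026-08-15, named-fact verdict clean-up of `KirbyMoves.lean`).** The named fact
`KirbyEquivalent.nonempty_diffeomorph` is mis-stated (false as stated: the tree's handle slides
`FramedLink.IsHandleSlide` admit collar-crossing bands; see the Errata of `KirbyMoves.lean` and the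
§Erratum of `KirbyMovesSurgery.lean`) and now carries the `deprecated` attribute; the corrected
statement is `StrictKirbyEquivalent.nonempty_diffeomorph` (`KirbyMovesStrictHandleSlide.lean`).
Accordingly `KirbyEquivalent.nonempty_diffeomorph_of_leaves` below, which concludes it (from the
mis-stated leaf (H) among others), is deprecated in favour of
`StrictKirbyEquivalent.nonempty_diffeomorph_of_leaves` (string form of the attribute: that file does
not import this one, nor conversely). Statements, proofs and names are unchanged.

**Deprecation (2026-08-15, named-fact verdict clean-up of `KirbyMovesSurgery.lean`).** The leaf (H)
`FramedLink.IsHandleSlide.isSurgery` itself now carries the `deprecated` attribute (verdict of its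
tenured fact seat: misstated — false as stated; corrected statement, under a new name because the
correction quantifies over the finer relation `FramedLink.IsStrictHandleSlide`:
`FramedLink.IsStrictHandleSlide.isSurgery`, `KirbyMovesStrictHandleSlide.lean`
[cite: Kirby1989, Ch. I §5 Thm 5.1]). Its remaining live user in this file,
`KirbyMove.isSurgery_of_blowDown_handleSlide` (correct but idle: the hypothesis `hhs : (H)` can
never be fed), is therefore deprecated in favour of `StrictKirbyMove.isSurgery_of_blowDown_handleSlide`
(`KirbyMovesStrictHandleSlide.lean`; string form of the attribute, as above), which also keeps this
file free of deprecation warnings. Statements, proofs and names are unchanged; nothing was added or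
removed.

## References

* R. Kirby, *A calculus for framed links in `S³`*, Invent. Math. 45 (1978), 35–56, Thm 1.
  [cite: Kirby1978, Thm 1]
* R. C. Kirby, *The Topology of 4-Manifolds*, LNM 1374 (1989), Ch. I §5 Thm 5.1.
  [cite: Kirby1989, Ch. I §5 Thm 5.1]
* A. Juhász, *Differential and Low-Dimensional Topology* (2023), §6.1, Thm 6.4.
  [cite: Juhasz2023, §6.1 Thm 6.4]
-/

open scoped Manifold ContDiff Topology

noncomputable section

namespace Literature.Topology.FourManifolds

/-- Local notation: `𝔼 n` is the model Euclidean space `EuclideanSpace ℝ (Fin n)`. -/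
local notation "𝔼 " n:arg => EuclideanSpace ℝ (Fin n)

universe v w

variable [SphereEmbedding.SmoothnessFacts] [Knot.TubularNbhd.SmoothnessFacts]

/-- **Deprecated (2026-08-15) with its hypothesis, the mis-stated leaf (H)
`FramedLink.IsHandleSlide.isSurgery` (`KirbyMovesSurgery.lean`); use
`StrictKirbyMove.isSurgery_of_blowDown_handleSlide` of `KirbyMovesStrictHandleSlide.lean`.** The
theorem is correct but idle: its hypothesis `hhs : (H)` is false as stated (module docstring of
`KirbyMovesSurgery.lean`, §Erratum), so it can never be fed. **A Kirby move does not change the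
surgered manifold**, given the leaves (B) blow-down and (H) handle slide (isotopy, renumbering and
reversal being proved): `KirbyMove.isSurgery_of` fed with `FramedLink.IsSurgery.of_isIsotopic_holds`
and `FramedLink.IsSurgery.reverseComponent_holds`. The statement and proof are unchanged. Kirby
(1989), Ch. I §5 Thm 5.1. [cite: Kirby1989, Ch. I §5 Thm 5.1] -/
@[deprecated "idle: its hypothesis (H) `FramedLink.IsHandleSlide.isSurgery` is mis-stated (false as stated) and deprecated: use Literature.Topology.FourManifolds.StrictKirbyMove.isSurgery_of_blowDown_handleSlide of KirbyMovesStrictHandleSlide.lean (strict handle slides, corrected leaf FramedLink.IsStrictHandleSlide.isSurgery)" (since := "2026-08-15")]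
theorem KirbyMove.isSurgery_of_blowDown_handleSlide
    (hbd : FramedLink.IsBlowDown.isSurgery.{v, 0})
    (hhs : FramedLink.IsHandleSlide.isSurgery.{v, 0})
    {L L' : FramedLinkFin} (h : KirbyMove L L')
    {Y : Type v} [TopologicalSpace Y] [T2Space Y] [SecondCountableTopology Y]
    [ChartedSpace (𝔼 3) Y] [IsManifold (𝓡 3) ∞ Y] (hY : L.2.IsSurgery (𝓡 3) Y) :
    L'.2.IsSurgery (𝓡 3) Y :=
  KirbyMove.isSurgery_of FramedLink.IsSurgery.of_isIsotopic_holds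
    FramedLink.IsSurgery.reverseComponent_holds hbd hhs h hY

/-- **Deprecated (2026-08-15) with its conclusion, the mis-stated named fact
`KirbyEquivalent.nonempty_diffeomorph` (`KirbyMoves.lean`); use
`StrictKirbyEquivalent.nonempty_diffeomorph_of_leaves` of `KirbyMovesStrictHandleSlide.lean`.** The
theorem is correct but idle: its hypothesis (H) `FramedLink.IsHandleSlide.isSurgery` is false as
stated, and so is its conclusion (module docstring). **Kirby's theorem, "if" direction, from the
four open leaves** (E) existence and (U) uniqueness of surgery on a framed link, (B) blow-down and
(H) handle-slide invariance: `KirbyEquivalent.nonempty_diffeomorph_of` fed with the discharged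
leaves (I) `FramedLink.IsSurgery.of_isIsotopic_holds` and (V)
`FramedLink.IsSurgery.reverseComponent_holds`. The statement and proof are unchanged. Kirby (1978),
Thm 1 "if"; Juhász (2023), Thm 6.4. [cite: Kirby1978, Thm 1 "if"] -/
@[deprecated "concludes the mis-stated (false as stated) `KirbyEquivalent.nonempty_diffeomorph` from the mis-stated leaf (H) `FramedLink.IsHandleSlide.isSurgery`: use Literature.Topology.FourManifolds.StrictKirbyEquivalent.nonempty_diffeomorph_of_leaves of KirbyMovesStrictHandleSlide.lean" (since := "2026-08-15")]
theorem KirbyEquivalent.nonempty_diffeomorph_of_leaves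
    (hex : FramedLink.exists_isSurgery.{0})
    (huniq₀ : FramedLink.IsSurgery.nonempty_diffeomorph.{0, 0, 0})
    (huniq₁ : FramedLink.IsSurgery.nonempty_diffeomorph.{v, 0, 0})
    (huniq₂ : FramedLink.IsSurgery.nonempty_diffeomorph.{0, w, 0})
    (hbd : FramedLink.IsBlowDown.isSurgery.{0, 0})
    (hhs : FramedLink.IsHandleSlide.isSurgery.{0, 0}) :
    KirbyEquivalent.nonempty_diffeomorph.{v, w} :=
  KirbyEquivalent.nonempty_diffeomorph_of hex huniq₀ huniq₁ huniq₂
    FramedLink.IsSurgery.of_isIsotopic_holds FramedLink.IsSurgery.reverseComponent_holds hbd hhs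

end Literature.Topology.FourManifolds
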